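import Summits.AnomalousDissipation.AnomalousDissipation.Theorems.SolenoidalFractalHomogenisationLagrangianStepCellChainDuhamel
import Summits.AnomalousDissipation.AnomalousDissipation.Theorems.SolenoidalFractalHomogenisationLagrangianStepSidebandSkew
import Summits.AnomalousDissipation.AnomalousDissipation.Theorems.SolenoidalFractalHomogenisationLagrangianStepW7ThreeModeFibre
import HarnessLib

/-!
# K1L_D (stmt-AnomalousDissipation-27980): (V_mod) flat stage, block (ss) — THE GENERATOR REGIME at the weak-solution level:
# the slow mode of the cell solution against the slow mode of the carrier-free solution, linear in time
(helper; `--supports 27980 --as helper`; prover ad-sawtooth-k1loc-p1 g15; regime row «τ ≤ P / y < 1» of the certifier's table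
`Cruxes/LagrangianRenormalisationStep/Lines/onelevel-ss-regimes.md` v2 (planner ad-ideate-p5 g14), tool T-G with the sideband slaving L-sb.)

For ONE lattice word `W₁`, a single real mode pair datum `F` at the slow label `ℓ` (`L²`, weakly divergence free, Fourier support `{ℓ, −ℓ}`,
`2|ℓ| < n`), a weak solution `u` of the CELL problem (carrier `W₁.cell n`, tensor `𝔹U`) and a weak solution `w` of the CARRIER-FREE problem
(carrier `W₁.cell 0 = 0`, tensor `𝔹T`) from the same datum, the continuous representatives of the slow mode (`CellChain.modeRep`, prover
ad-k1l-cellLawV-w1 g4/g5) satisfy the classical chain ODEs (`CellChain.hasDerivAt_modeRep`)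
`x_u' = −4π²P_ℓT_{𝔹Uᵀ}(ℓ)x_u − LF(s)`, `x_w' = −4π²P_ℓT_{𝔹Tᵀ}(ℓ)x_w` (`LF` = the two-neighbour link forcing of the sidebands `ℓ ± n·mⱼ`).
Hence `z = x_u − x_w` solves `z' = −4π²P_ℓT_{𝔹Uᵀ}(ℓ)P_ℓ z + g`, `g = −4π²P_ℓ(T_{𝔹Uᵀ} − T_{𝔹Tᵀ})(ℓ)x_w − LF`, `z(0) = 0`, with an
accretive generator, so that (Duhamel, `CellChain.norm_le_exp_add_integral_of_hasDerivAt`)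

  `‖x_u(t) − x_w(t)‖ ≤ (4π²·D·X + Lf)·t`      (`norm_modeRep_sub_le`)

where `D` bounds the projected symbol difference on transversal vectors, `X` bounds `‖x_w‖` and `Lf` bounds `‖LF‖` on `[0,T]`
(abstract form `norm_sub_le_of_slow_odes`).  The symbol input is discharged here: `norm_transversalProj_symbT_le`
(`‖P_k T_{𝔻ᵀ}(k) y‖ ≤ (hi + β/2)|k|²‖y‖` for transversal `y`, from the three-mode form bound `ThreeMode.re_inner_symbT_le`); the link-forcing input
(sideband slaving of a pair datum, `‖LF‖ ≤ 32ξ²(Σ‖α‖)²‖F‖/lo`) is the sequel file `…VmodLinkForcing`.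
`sorry`-free; NOT a proof of (ss), of the stub, of K1L_D or of AD; rung F-D1.A0.
-/

set_option linter.dupNamespace false

noncomputable section

namespace Summit.AnomalousDissipation.AnomalousDissipation.Theorems.SolenoidalFractalHomogenisation.LagrangianStep.VmodGen

open Set MeasureTheory Complex UnitAddTorus NormedSpace
open scoped InnerProductSpace
open Literature.Analysis Literature.Analysis.FunctionSpaces Literature.Analysis.FunctionSpaces.Torus
open Literature.Analysis.FluidPDE Literature.Analysis.FluidPDE.Torus Literature.Analysis.FluidPDE.LatticeShear
open Summit.AnomalousDissipation.AnomalousDissipation.Theorems.SolenoidalFractalHomogenisation.LagrangianStep.CellChain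
  (modeRep modeRep_zero modeRep_def continuousOn_modeRep kdot_modeRep hasDerivAt_modeRep linkCoeff linkCoeff_def
   kdot_transversalProj' norm_le_exp_add_integral_of_hasDerivAt)
open Summit.AnomalousDissipation.AnomalousDissipation.Theorems.SolenoidalFractalHomogenisation.LagrangianStep.Sideband
  (re_inner_transversalProj_symbT_ge)
open Summit.AnomalousDissipation.AnomalousDissipation.Theorems.SolenoidalFractalHomogenisation.LagrangianStep.ThreeMode (re_inner_symbT_le)

variable {k₀ : ℕ}

/-! ## §1 A forced linear ODE with an accretive generator grows at most linearly from zero -/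

section Generic

variable {E : Type*} [NormedAddCommGroup E] [InnerProductSpace ℝ E] [CompleteSpace E]

/-- **Forced accretive flow from zero.**  If `⟪Gv, v⟫ ≥ 0`, `z` is continuous on `[0,T]` with `z' = −G z + g` on `(0,T)`, `z 0 = 0`, `g` continuous
on `[0,T]` with `‖g‖ ≤ B` there, then `‖z t‖ ≤ B·t` on `[0,T]`. [cite: Hale1980, Ch. III §1, Theorem 1.1] -/
theorem norm_le_mul_of_forced (G : E →L[ℝ] E) (hG : ∀ v, 0 ≤ ⟪G v, v⟫_ℝ) {z g : ℝ → E} {T B : ℝ}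
    (hzc : ContinuousOn z (Icc 0 T)) (hgc : ContinuousOn g (Icc 0 T))
    (hz : ∀ s ∈ Ioo 0 T, HasDerivAt z (-(G (z s)) + g s) s) (hz0 : z 0 = 0)
    (hB : ∀ s ∈ Icc 0 T, ‖g s‖ ≤ B) :
    ∀ t ∈ Icc 0 T, ‖z t‖ ≤ B * t := by
  intro t ht
  have hsub : Icc 0 t ⊆ Icc 0 T := Icc_subset_Icc le_rfl ht.2
  have hG' : ∀ v, (0:ℝ) * ‖v‖ ^ 2 ≤ ⟪G v, v⟫_ℝ := fun v => by rw [zero_mul]; exact hG v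
  have key := norm_le_exp_add_integral_of_hasDerivAt G hG' ht.1 (hzc.mono hsub) (hgc.mono hsub)
    (fun s hs => hz s ⟨hs.1, lt_of_lt_of_le hs.2 ht.2⟩)
  rw [hz0, norm_zero, mul_zero, zero_add] at key
  have hint : ∫ s in (0:ℝ)..t, Real.exp (-(0 * (t - s))) * ‖g s‖ = ∫ s in (0:ℝ)..t, ‖g s‖ := by
    refine intervalIntegral.integral_congr fun s _ => ?_
    simp only [zero_mul, neg_zero, Real.exp_zero, one_mul]
  rw [hint] at key
  have hb := intervalIntegral.norm_integral_le_of_norm_le_const (a := 0) (b := t) (C := B) (f := fun s => ‖g s‖)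
    (fun s hs => by rw [uIoc_of_le ht.1] at hs; rw [norm_norm]; exact hB s ⟨hs.1.le, hs.2.trans ht.2⟩)
  rw [sub_zero, abs_of_nonneg ht.1, Real.norm_eq_abs] at hb
  exact key.trans ((le_abs_self _).trans hb)

end Generic

/-! ## §2 The projected symbol of a windowed tensor is bounded on transversal vectors -/

/-- **`‖P_k T_{𝔻ᵀ}(k) y‖ ≤ (hi + β/2)·|k|²·‖y‖`** for transversal `y`, `NearIso 𝔻 lo hi` (`0 ≤ lo`, `0 ≤ hi`), `OddSmall 𝔻 β` (`0 ≤ β`).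
[cite: Frisch1995Turbulence, §9.6.3 eq. (9.57) p. 233] -/
theorem norm_transversalProj_symbT_le {𝔻 : Visc4 (Fin 3)} {lo hi β : ℝ} (h𝔻 : NearIso 𝔻 lo hi) (hlo : 0 ≤ lo) (hhi : 0 ≤ hi)
    (hodd : OddSmall 𝔻 β) (hβ : 0 ≤ β) (k : Fin 3 → ℤ) {y : EuclideanSpace ℂ (Fin 3)} (hy : kdot k y = 0) :
    ‖transversalProj k (symbT (majorTranspose 𝔻) k y)‖ ≤ (hi + β / 2) * freqNormSq k * ‖y‖ := by
  set v := transversalProj k (symbT (majorTranspose 𝔻) k y) with hv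
  have hvk : kdot k v = 0 := kdot_transversalProj' k _
  have hT : NearIso (majorTranspose 𝔻) lo hi := (nearIso_majorTranspose_iff 𝔻 lo hi).2 h𝔻
  have hO : OddSmall (majorTranspose 𝔻) β := hodd.majorTranspose
  have h1 : ‖v‖ ^ 2 = (⟪v, symbT (majorTranspose 𝔻) k y⟫_ℂ).re := by
    rw [← inner_transversalProj_right_of_kdot_eq_zero k hvk, ← hv]
    have := inner_self_eq_norm_sq_to_K (𝕜 := ℂ) v
    rw [this]; norm_cast
  have h2 := re_inner_symbT_le hT hlo hhi hO hβ k hvk hy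
  have hc : 0 ≤ (hi + β / 2) * freqNormSq k * ‖y‖ := by
    have := freqNormSq_nonneg k; positivity
  by_cases hv0 : ‖v‖ = 0
  · rw [hv0]; exact hc
  · have hvpos : 0 < ‖v‖ := lt_of_le_of_ne (norm_nonneg _) (Ne.symm hv0)
    have h3 : ‖v‖ * ‖v‖ ≤ (hi + β / 2) * freqNormSq k * ‖y‖ * ‖v‖ := by
      calc ‖v‖ * ‖v‖ = ‖v‖ ^ 2 := by ring
        _ ≤ (hi + β / 2) * freqNormSq k * (‖y‖ * ‖v‖) := h1.le.trans h2
        _ = _ := by ring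
    exact le_of_mul_le_mul_right h3 hvpos

/-! ## §3 The carrier-free problem is the cell problem with `n = 0` cells -/

/-- `W₁.cell 0` is the zero carrier (`(1/0) • _ = 0`). [folklore] -/
theorem cell_zero_eq (W₁ : LatticeWord k₀) : W₁.cell 0 = fun (_ : ℝ) (_ : UnitAddTorus (Fin 3)) => (0 : EuclideanSpace ℝ (Fin 3)) := by
  funext t x
  simp [LatticeWord.cell]

/-- With `0` cells there are no links: `linkCoeff W₁ 0 k j τ = 0`. [folklore] -/
theorem linkCoeff_zero_cells (W₁ : LatticeWord k₀) (k : Fin 3 → ℤ) (j : Fin k₀) (τ : ℝ) : linkCoeff W₁ 0 k j τ = 0 := by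
  rw [linkCoeff_def]
  simp

/-! ## §4 The slow mode of the cell solution against the slow mode of the carrier-free solution -/

/-- **Two slow-mode ODEs, one forced** (abstract form of T-G).  `xu' = −4π²P_ℓT_{𝔹Uᵀ}(ℓ)xu − LF`, `xw' = −4π²P_ℓT_{𝔹Tᵀ}(ℓ)xw` on `(0,T)`,
both transversal and continuous on `[0,T]`, `xu 0 = xw 0`, `NearIso 𝔹U loU hiU` with `loU ≥ 0`, `ℓ ≠ 0`; if the projected symbol difference is
`≤ D‖y‖` on transversal `y`, `‖xw‖ ≤ X` and `‖LF‖ ≤ Lf` on `[0,T]`, then `‖xu t − xw t‖ ≤ (4π²·D·X + Lf)·t` on `[0,T]`.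
[cite: Hale1980, Ch. III §1, Theorem 1.1] -/
theorem norm_sub_le_of_slow_odes {T : ℝ} {𝔹U 𝔹T : Visc4 (Fin 3)} {loU hiU : ℝ}
    (h𝔹U : NearIso 𝔹U loU hiU) (hloU : 0 ≤ loU) {ℓ : Fin 3 → ℤ} (hℓ : ℓ ≠ 0)
    {xu xw LF : ℝ → EuclideanSpace ℂ (Fin 3)}
    (hxuc : ContinuousOn xu (Icc 0 T)) (hxwc : ContinuousOn xw (Icc 0 T)) (hLFc : ContinuousOn LF (Icc 0 T))
    (hxuk : ∀ s ∈ Icc 0 T, kdot ℓ (xu s) = 0) (hxwk : ∀ s ∈ Icc 0 T, kdot ℓ (xw s) = 0)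
    (hdu : ∀ s ∈ Ioo 0 T, HasDerivAt xu
      (-(((4 * Real.pi ^ 2 : ℝ) : ℂ) • transversalProj ℓ (symbT (majorTranspose 𝔹U) ℓ (xu s))) - LF s) s)
    (hdw : ∀ s ∈ Ioo 0 T, HasDerivAt xw
      (-(((4 * Real.pi ^ 2 : ℝ) : ℂ) • transversalProj ℓ (symbT (majorTranspose 𝔹T) ℓ (xw s)))) s)
    (h0 : xu 0 = xw 0) {D X Lf : ℝ} (hD0 : 0 ≤ D)
    (hD : ∀ y : EuclideanSpace ℂ (Fin 3), kdot ℓ y = 0 →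
      ‖transversalProj ℓ (symbT (majorTranspose 𝔹U) ℓ y) - transversalProj ℓ (symbT (majorTranspose 𝔹T) ℓ y)‖ ≤ D * ‖y‖)
    (hX : ∀ s ∈ Icc 0 T, ‖xw s‖ ≤ X) (hLf : ∀ s ∈ Icc 0 T, ‖LF s‖ ≤ Lf) :
    ∀ t ∈ Icc 0 T, ‖xu t - xw t‖ ≤ (4 * Real.pi ^ 2 * D * X + Lf) * t := by
  -- the accretive generator `G v = 4π² P T_{𝔹Uᵀ} P v`
  set G : EuclideanSpace ℂ (Fin 3) →L[ℝ] EuclideanSpace ℂ (Fin 3) :=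
    ((modalAdjGen (majorTranspose 𝔹U) ℓ).comp (transversalProj ℓ)).restrictScalars ℝ with hG
  have hGapply : ∀ v, G v = ((4 * Real.pi ^ 2 : ℝ) : ℂ) • transversalProj ℓ (symbT (majorTranspose 𝔹U) ℓ (transversalProj ℓ v)) := by
    intro v; rw [hG, ContinuousLinearMap.coe_restrictScalars', ContinuousLinearMap.comp_apply, modalAdjGen_apply]
  have hGacc : ∀ v, 0 ≤ ⟪G v, v⟫_ℝ := by
    intro v
    rw [show ⟪G v, v⟫_ℝ = (⟪G v, v⟫_ℂ).re from real_inner_eq_re_inner ℂ _ _, hGapply, inner_smul_left]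
    have h1 := re_inner_transversalProj_symbT_ge h𝔹U hloU hℓ v
    have h2 : 0 ≤ (⟪transversalProj ℓ (symbT (majorTranspose 𝔹U) ℓ (transversalProj ℓ v)), v⟫_ℂ).re :=
      le_trans (mul_nonneg hloU (sq_nonneg _)) h1
    have hc : (starRingEnd ℂ) (((4 * Real.pi ^ 2 : ℝ) : ℂ)) = ((4 * Real.pi ^ 2 : ℝ) : ℂ) := Complex.conj_ofReal _
    rw [hc, Complex.re_ofReal_mul]
    exact mul_nonneg (by positivity) h2
  -- the forcing
  set g : ℝ → EuclideanSpace ℂ (Fin 3) := fun s =>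
    -(((4 * Real.pi ^ 2 : ℝ) : ℂ) • (transversalProj ℓ (symbT (majorTranspose 𝔹U) ℓ (xw s)) -
        transversalProj ℓ (symbT (majorTranspose 𝔹T) ℓ (xw s)))) - LF s with hg
  have hPTc : ∀ 𝔹 : Visc4 (Fin 3), Continuous fun y : EuclideanSpace ℂ (Fin 3) => transversalProj ℓ (symbT (majorTranspose 𝔹) ℓ y) :=
    fun 𝔹 => (transversalProj ℓ).continuous.comp (symbTL (majorTranspose 𝔹) ℓ).continuous
  have hzc : ContinuousOn (fun s => xu s - xw s) (Icc 0 T) := hxuc.sub hxwc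
  have hgc : ContinuousOn g (Icc 0 T) := by
    have h1 : ContinuousOn (fun s => transversalProj ℓ (symbT (majorTranspose 𝔹U) ℓ (xw s)) -
        transversalProj ℓ (symbT (majorTranspose 𝔹T) ℓ (xw s))) (Icc 0 T) :=
      ((hPTc 𝔹U).comp_continuousOn hxwc).sub ((hPTc 𝔹T).comp_continuousOn hxwc)
    exact (h1.const_smul (((4 * Real.pi ^ 2 : ℝ) : ℂ))).neg.sub hLFc
  -- the ODE for `z = xu − xw`
  have hz : ∀ s ∈ Ioo 0 T, HasDerivAt (fun s => xu s - xw s) (-(G (xu s - xw s)) + g s) s := by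
    intro s hs
    have hd := (hdu s hs).sub (hdw s hs)
    refine hd.congr_deriv ?_
    have hsI : s ∈ Icc 0 T := ⟨hs.1.le, hs.2.le⟩
    have hzk : kdot ℓ (xu s - xw s) = 0 := by rw [map_sub, hxuk s hsI, hxwk s hsI, sub_zero]
    have hPz : transversalProj ℓ (xu s - xw s) = xu s - xw s := transversalProj_eq_self_of_kdot_eq_zero ℓ hzk
    have hsymb_sub : symbT (majorTranspose 𝔹U) ℓ (xu s - xw s) =
        symbT (majorTranspose 𝔹U) ℓ (xu s) - symbT (majorTranspose 𝔹U) ℓ (xw s) :=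
      map_sub (symbTL (majorTranspose 𝔹U) ℓ) (xu s) (xw s)
    rw [hGapply, hPz, hsymb_sub, map_sub, smul_sub, hg]
    dsimp only
    rw [smul_sub]
    abel
  have hz0 : xu 0 - xw 0 = 0 := by rw [h0, sub_self]
  -- the forcing bound
  have hB : ∀ s ∈ Icc 0 T, ‖g s‖ ≤ 4 * Real.pi ^ 2 * D * X + Lf := by
    intro s hs
    have h1 := hD (xw s) (hxwk s hs)
    have h2 := hX s hs
    have h3 := hLf s hs
    have hn4 : ‖((4 * Real.pi ^ 2 : ℝ) : ℂ)‖ = 4 * Real.pi ^ 2 := by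
      rw [Complex.norm_real, Real.norm_eq_abs, abs_of_nonneg (by positivity)]
    calc ‖g s‖ ≤ ‖((4 * Real.pi ^ 2 : ℝ) : ℂ) • (transversalProj ℓ (symbT (majorTranspose 𝔹U) ℓ (xw s)) -
            transversalProj ℓ (symbT (majorTranspose 𝔹T) ℓ (xw s)))‖ + ‖LF s‖ := by
          rw [hg]; exact (norm_sub_le _ _).trans (by rw [norm_neg])
      _ ≤ 4 * Real.pi ^ 2 * (D * X) + Lf := by
          refine add_le_add ?_ h3
          rw [norm_smul, hn4]
          refine mul_le_mul_of_nonneg_left (h1.trans ?_) (by positivity)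
          exact mul_le_mul_of_nonneg_left h2 hD0
      _ = _ := by ring
  exact norm_le_mul_of_forced G hGacc hzc hgc hz hz0 hB

/-- The two-neighbour link forcing of the slow mode is continuous on `[0,T]` (representatives and link coefficients are). [folklore] -/
theorem continuousOn_linkForcing (W₁ : LatticeWord k₀) (n : ℕ) {T : ℝ} (hT : 0 ≤ T) {𝔹 : Visc4 (Fin 3)}
    {F : UnitAddTorus (Fin 3) → EuclideanSpace ℝ (Fin 3)} {u : ℝ → UnitAddTorus (Fin 3) → EuclideanSpace ℝ (Fin 3)}
    (h : IsWeakTensorPassiveVectorOn 0 T 𝔹 (W₁.cell n) F u) (k : Fin 3 → ℤ) :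
    ContinuousOn (fun s => ∑ j, linkCoeff W₁ n k j s • transversalProj k
          ((Complex.exp ((W₁.phase j).φ * Complex.I) * (1 / (2 * ((2 * Real.pi * ‖latticeVec (W₁.phase j).m‖ : ℝ) : ℂ) * Complex.I))) •
              modeRep W₁ n 𝔹 F u (k - fun i => (W₁.phase j).m i * n) s +
            (starRingEnd ℂ (Complex.exp ((W₁.phase j).φ * Complex.I)) *
                (-(1 / (2 * ((2 * Real.pi * ‖latticeVec (W₁.phase j).m‖ : ℝ) : ℂ) * Complex.I)))) •
              modeRep W₁ n 𝔹 F u (k + fun i => (W₁.phase j).m i * n) s)) (Icc 0 T) := by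
  have hrep : ∀ k', ContinuousOn (modeRep W₁ n 𝔹 F u k') (Icc 0 T) := fun k' => continuousOn_modeRep W₁ n hT h k'
  refine continuousOn_finsetSum _ fun j _ => ?_
  have ha : ContinuousOn (fun t =>
      (Complex.exp ((W₁.phase j).φ * Complex.I) * (1 / (2 * ((2 * Real.pi * ‖latticeVec (W₁.phase j).m‖ : ℝ) : ℂ) * Complex.I))) •
            modeRep W₁ n 𝔹 F u (k - fun i => (W₁.phase j).m i * n) t +
          (starRingEnd ℂ (Complex.exp ((W₁.phase j).φ * Complex.I)) *
              (-(1 / (2 * ((2 * Real.pi * ‖latticeVec (W₁.phase j).m‖ : ℝ) : ℂ) * Complex.I)))) •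
            modeRep W₁ n 𝔹 F u (k + fun i => (W₁.phase j).m i * n) t) (Icc 0 T) :=
    ((hrep (k - fun i => (W₁.phase j).m i * n)).const_smul
      (Complex.exp ((W₁.phase j).φ * Complex.I) * (1 / (2 * ((2 * Real.pi * ‖latticeVec (W₁.phase j).m‖ : ℝ) : ℂ) * Complex.I)))).add
      ((hrep (k + fun i => (W₁.phase j).m i * n)).const_smul
        (starRingEnd ℂ (Complex.exp ((W₁.phase j).φ * Complex.I)) *
          (-(1 / (2 * ((2 * Real.pi * ‖latticeVec (W₁.phase j).m‖ : ℝ) : ℂ) * Complex.I)))))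
  exact (CellChain.continuous_linkCoeff W₁ n k j).continuousOn.smul ((transversalProj k).continuous.comp_continuousOn ha)

/-- **T-G at the weak-solution level.**  `u` solves the cell problem (carrier `W₁.cell n`, tensor `𝔹U ∈ NearIso loU hiU`, `loU ≥ 0`), `w` the
carrier-free problem (carrier `W₁.cell 0`, tensor `𝔹T`) from the same `L¹` datum; `ℓ ≠ 0`.  If on transversal vectors the projected symbol difference
is `≤ D‖y‖`, the carrier-free slow mode is `≤ X` and the link forcing of `u` at `ℓ` is `≤ Lf` on `[0,T]`, then for all `t ∈ [0,T]`
`‖x_u(t) − x_w(t)‖ ≤ (4π²·D·X + Lf)·t`. [cite: Hale1980, Ch. III §1, Theorem 1.1] [cite: MeshalkinSinai1961, pp. 1700–1705] -/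
theorem norm_modeRep_sub_le (W₁ : LatticeWord k₀) (n : ℕ) {T : ℝ} (hT : 0 ≤ T) {𝔹U 𝔹T : Visc4 (Fin 3)} {loU hiU : ℝ}
    (h𝔹U : NearIso 𝔹U loU hiU) (hloU : 0 ≤ loU)
    {F : UnitAddTorus (Fin 3) → EuclideanSpace ℝ (Fin 3)} (hF : Integrable F volume)
    {u w : ℝ → UnitAddTorus (Fin 3) → EuclideanSpace ℝ (Fin 3)}
    (hu : IsWeakTensorPassiveVectorOn 0 T 𝔹U (W₁.cell n) F u) (hw : IsWeakTensorPassiveVectorOn 0 T 𝔹T (W₁.cell 0) F w)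
    {ℓ : Fin 3 → ℤ} (hℓ : ℓ ≠ 0) {D X Lf : ℝ} (hD0 : 0 ≤ D)
    (hD : ∀ y : EuclideanSpace ℂ (Fin 3), kdot ℓ y = 0 →
      ‖transversalProj ℓ (symbT (majorTranspose 𝔹U) ℓ y) - transversalProj ℓ (symbT (majorTranspose 𝔹T) ℓ y)‖ ≤ D * ‖y‖)
    (hX : ∀ s ∈ Icc 0 T, ‖modeRep W₁ 0 𝔹T F w ℓ s‖ ≤ X)
    (hLf : ∀ s ∈ Icc 0 T, ‖∑ j, linkCoeff W₁ n ℓ j s • transversalProj ℓ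
          ((Complex.exp ((W₁.phase j).φ * Complex.I) * (1 / (2 * ((2 * Real.pi * ‖latticeVec (W₁.phase j).m‖ : ℝ) : ℂ) * Complex.I))) •
              modeRep W₁ n 𝔹U F u (ℓ - fun i => (W₁.phase j).m i * n) s +
            (starRingEnd ℂ (Complex.exp ((W₁.phase j).φ * Complex.I)) *
                (-(1 / (2 * ((2 * Real.pi * ‖latticeVec (W₁.phase j).m‖ : ℝ) : ℂ) * Complex.I)))) •
              modeRep W₁ n 𝔹U F u (ℓ + fun i => (W₁.phase j).m i * n) s)‖ ≤ Lf) :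
    ∀ t ∈ Icc 0 T, ‖modeRep W₁ n 𝔹U F u ℓ t - modeRep W₁ 0 𝔹T F w ℓ t‖ ≤ (4 * Real.pi ^ 2 * D * X + Lf) * t := by
  refine norm_sub_le_of_slow_odes h𝔹U hloU hℓ (continuousOn_modeRep W₁ n hT hu ℓ) (continuousOn_modeRep W₁ 0 hT hw ℓ)
    (continuousOn_linkForcing W₁ n hT hu ℓ) (fun s hs => kdot_modeRep W₁ n hT hu ℓ hs) (fun s hs => kdot_modeRep W₁ 0 hT hw ℓ hs)
    (fun s hs => hasDerivAt_modeRep W₁ n hu hF ℓ hs) (fun s hs => ?_) ?_ hD0 hD hX hLf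
  · refine (hasDerivAt_modeRep W₁ 0 hw hF ℓ hs).congr_deriv ?_
    rw [Finset.sum_eq_zero fun j _ => by rw [linkCoeff_zero_cells, zero_smul], sub_zero]
  · rw [modeRep_zero, modeRep_zero]

end Summit.AnomalousDissipation.AnomalousDissipation.Theorems.SolenoidalFractalHomogenisation.LagrangianStep.VmodGen

end
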